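/-
Copyright (c) 2026. All rights reserved.
Released under Apache 2.0 license as described in the file LICENSE.
Authors: abc-iut cell, seat abc-iut-w6-d109 (gen 2).
-/
import Mathlib.GroupTheory.Nilpotent
import Mathlib.GroupTheory.PGroup

/-!
# The lower `q`-central series of a finite `p`-group terminates

For a normal subgroup `Q ⊴ G` and an exponent `q`, the LOWER `q`-CENTRAL SERIES of `Q` inside `G` is
`D 0 = Q`, `D (j+1) = ⁅D j, Q⁆ ⊔ ⟨{y ^ q | y ∈ D j}⟩` (J. D. Dixon, M. du Sautoy, A. Mann, D. Segal,
*Analytic pro-`p` groups*, 2nd ed., §1.2, the "lower `p`-series" when `q = p`; here an arbitrary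
exponent, taken as a HYPOTHESIS on a sequence `D : ℕ → Subgroup G` — no definition is introduced).

* `eq_bot_of_le_commutator_sup_powClosure` — if `Q` is a finite `p`-group, `p ∣ q`, and a normal
  subgroup `K ≤ Q` satisfies `K ≤ ⁅K, Q⁆ · ⟨K ^ q⟩`, then `K = ⊥` (modulo `⁅K, Q⁆` the `q`-power map of
  the abelian group `K / ⁅K, Q⁆` would be surjective, so `K ≤ ⁅K, Q⁆`, whence `K ≤ γ_i(Q)` for all `i`);
* `exists_lowerPowSeries_eq_bot` — consequently the lower `q`-central series of a finite `p`-group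
  `Q` (with `p ∣ q`) reaches `⊥`: it is strictly decreasing as long as it is nontrivial.

Consumer: the twisted commutator width theorem `commutator_sup_powClosure_eq_wordSet`
(`TwistedCommutatorWidthSeries.lean`) in finite quotients of profinite groups
(`TwistedCommutatorWidthProfinite.lean`).

[cite: DDMSAnalyticProP1999, §1.2, Prop 1.16]
-/

namespace Literature.GroupTheory

open scoped Pointwise commutatorElement

variable {G : Type*} [Group G]

/-- In a finite `p`-group `K`, `x ^ (q ^ a) = 1` for all `x ∈ K` as soon as `p ∣ q` and
`Nat.card K = p ^ a`. [cite: DDMSAnalyticProP1999, §1.2] -/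
theorem pow_pow_eq_one_of_card_eq (K : Subgroup G) {p q a : ℕ} (hpq : p ∣ q)
    (hcard : Nat.card K = p ^ a) {x : G} (hx : x ∈ K) : x ^ q ^ a = 1 := by
  obtain ⟨r, hr⟩ := pow_dvd_pow_of_dvd hpq a
  have h1 : (⟨x, hx⟩ : K) ^ p ^ a = 1 := by rw [← hcard]; exact pow_card_eq_one'
  have h2 : x ^ p ^ a = 1 := by
    have := congrArg Subtype.val h1
    simpa only [Subgroup.coe_pow, Subgroup.coe_one] using this
  rw [hr, pow_mul, h2, one_pow]

/-- For `π, π' ∈ K ≤ Q`: `(π π')^q = π^q π'^q μ` with `μ ∈ ⁅K, Q⁆` (the classes commute modulo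
`⁅K, Q⁆ ⊇ ⁅K, K⁆`). [cite: DDMSAnalyticProP1999, §1.2] -/
theorem exists_mul_pow_eq_pow_mul_of_le (K Q : Subgroup G) [K.Normal] [Q.Normal] (hKQ : K ≤ Q)
    (q : ℕ) {y c : G} (hy : y ∈ K) (hc : c ∈ K) :
    ∃ μ ∈ ⁅K, Q⁆, (y * c) ^ q = y ^ q * c ^ q * μ := by
  have hcomm : (QuotientGroup.mk y : G ⧸ ⁅K, Q⁆) * QuotientGroup.mk c =
      QuotientGroup.mk c * QuotientGroup.mk y := by
    rw [← QuotientGroup.mk_mul, ← QuotientGroup.mk_mul, QuotientGroup.eq]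
    have : (y * c)⁻¹ * (c * y) = ⁅c⁻¹, y⁻¹⁆ := by
      simp only [commutatorElement_def, mul_inv_rev, inv_inv, mul_assoc]
    rw [this]
    exact Subgroup.commutator_mem_commutator (inv_mem hc) (hKQ (inv_mem hy))
  have h : (QuotientGroup.mk ((y * c) ^ q) : G ⧸ ⁅K, Q⁆) = QuotientGroup.mk (y ^ q * c ^ q) := by
    rw [QuotientGroup.mk_pow, QuotientGroup.mk_mul, (Commute.mul_pow hcomm q),
      QuotientGroup.mk_mul, QuotientGroup.mk_pow, QuotientGroup.mk_pow]
  refine ⟨(y ^ q * c ^ q)⁻¹ * (y * c) ^ q, QuotientGroup.eq.mp h.symm, ?_⟩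
  rw [mul_inv_cancel_left]

/-- If `K ≤ Q` are normal and `K ≤ ⁅K, Q⁆ ⊔ ⟨{y ^ q | y ∈ K}⟩`, then for every `t`,
`K ≤ ⁅K, Q⁆ ⊔ ⟨{y ^ (q ^ t) | y ∈ K}⟩` (iterate: modulo `⁅K, Q⁆` the `q`-power map of `K` is a
surjective endomorphism). [cite: DDMSAnalyticProP1999, §1.2] -/
theorem le_commutator_sup_powClosure_pow (K Q : Subgroup G) [hK : K.Normal] [Q.Normal]
    (hKQ : K ≤ Q) (q : ℕ)
    (hKle : K ≤ ⁅K, Q⁆ ⊔ Subgroup.closure ((fun y : G => y ^ q) '' (K : Set G))) (t : ℕ) :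
    K ≤ ⁅K, Q⁆ ⊔ Subgroup.closure ((fun y : G => y ^ q ^ t) '' (K : Set G)) := by
  induction t with
  | zero =>
    intro k hk
    exact Subgroup.mem_sup_right (Subgroup.subset_closure ⟨k, hk, by simp⟩)
  | succ t ih =>
    intro k hk
    set R : Subgroup G := ⁅K, Q⁆ ⊔ Subgroup.closure ((fun y : G => y ^ q ^ (t + 1)) '' (K : Set G))
      with hR
    have hMR : ⁅K, Q⁆ ≤ R := le_sup_left
    -- `q`-th powers of elements of `⁅K,Q⁆ ⊔ ⟨K^(q^t)⟩ ∩ K` lie in `R`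
    have hpowR : ∀ π ∈ Subgroup.closure ((fun y : G => y ^ q ^ t) '' (K : Set G)),
        π ∈ K ∧ π ^ q ∈ R := by
      intro π hπ
      induction hπ using Subgroup.closure_induction with
      | mem z hz =>
        obtain ⟨d, hd, rfl⟩ := hz
        refine ⟨K.pow_mem hd _, Subgroup.mem_sup_right (Subgroup.subset_closure ⟨d, hd, ?_⟩)⟩
        show d ^ q ^ (t + 1) = (d ^ q ^ t) ^ q
        rw [← pow_mul, ← pow_succ]
      | one => exact ⟨K.one_mem, by rw [one_pow]; exact R.one_mem⟩
      | mul z z' _ _ ih₁ ih₂ =>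
        refine ⟨K.mul_mem ih₁.1 ih₂.1, ?_⟩
        obtain ⟨μ, hμ, hμeq⟩ := exists_mul_pow_eq_pow_mul_of_le K Q hKQ q ih₁.1 ih₂.1
        rw [hμeq]
        exact R.mul_mem (R.mul_mem ih₁.2 ih₂.2) (hMR hμ)
      | inv z _ ih₁ =>
        exact ⟨K.inv_mem ih₁.1, by rw [inv_pow]; exact R.inv_mem ih₁.2⟩
    -- decompose `k = κ · π`, `κ ∈ ⁅K,Q⁆`, `π ∈ ⟨K^q⟩`, and push generators `c^q` through `ih`
    have hk' := hKle hk
    rw [Subgroup.commutator_def, ← Subgroup.closure_union] at hk'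
    clear hk
    induction hk' using Subgroup.closure_induction with
    | mem z hz =>
      rcases hz with hz | hz
      · exact hMR (by rw [Subgroup.commutator_def]; exact Subgroup.subset_closure hz)
      · obtain ⟨c, hc, rfl⟩ := hz
        -- `c ∈ K ≤ ⁅K,Q⁆ ⊔ ⟨K^(q^t)⟩`: `c = κ π`, so `c^q ≡ π^q (mod ⁅K,Q⁆)` with `π^q ∈ R`
        obtain ⟨κ, hκ, π, hπ, rfl⟩ := Subgroup.mem_sup_of_normal_left.mp (ih hc)
        obtain ⟨hπK, hπq⟩ := hpowR π hπ
        have hcong : (QuotientGroup.mk ((κ * π) ^ q) : G ⧸ ⁅K, Q⁆) = QuotientGroup.mk (π ^ q) := by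
          rw [QuotientGroup.mk_pow, QuotientGroup.mk_pow, QuotientGroup.mk_mul,
            (QuotientGroup.eq_one_iff κ).mpr hκ, one_mul]
        have hmem : (π ^ q)⁻¹ * (κ * π) ^ q ∈ ⁅K, Q⁆ := QuotientGroup.eq.mp hcong.symm
        have : (κ * π) ^ q = π ^ q * ((π ^ q)⁻¹ * (κ * π) ^ q) := by rw [mul_inv_cancel_left]
        show (fun y : G => y ^ q) (κ * π) ∈ R
        rw [show (fun y : G => y ^ q) (κ * π) = (κ * π) ^ q from rfl, this]
        exact R.mul_mem hπq (hMR hmem)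
    | one => exact R.one_mem
    | mul z z' _ _ ih₁ ih₂ => exact R.mul_mem ih₁ ih₂
    | inv z _ ih₁ => exact R.inv_mem ih₁

/-- **A normal subgroup `K` of a finite `p`-group `Q` with `K ≤ ⁅K, Q⁆ · ⟨K ^ q⟩ (`p ∣ q`) is
trivial.** Indeed `K ≤ ⁅K, Q⁆ ⊔ ⟨K ^ (q ^ a)⟩ = ⁅K, Q⁆` for `Nat.card K = p ^ a`, and a subgroup
`K ≤ ⁅K, Q⁆` of a nilpotent group lies in every term of the lower central series.
[cite: DDMSAnalyticProP1999, Prop 1.16] -/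
theorem eq_bot_of_le_commutator_sup_powClosure {p : ℕ} [hp : Fact p.Prime] (K Q : Subgroup G)
    [K.Normal] [Q.Normal] [Finite Q] (hQ : IsPGroup p Q) (hKQ : K ≤ Q) {q : ℕ} (hpq : p ∣ q)
    (hKle : K ≤ ⁅K, Q⁆ ⊔ Subgroup.closure ((fun y : G => y ^ q) '' (K : Set G))) : K = ⊥ := by
  haveI : Finite K := Finite.of_injective _ (Subgroup.inclusion_injective hKQ)
  have hK : IsPGroup p K := hQ.of_injective (Subgroup.inclusion hKQ) (Subgroup.inclusion_injective hKQ)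
  obtain ⟨a, ha⟩ := (IsPGroup.iff_card).mp hK
  -- `K ≤ ⁅K, Q⁆`
  have hKM : K ≤ ⁅K, Q⁆ := by
    intro k hk
    have h := le_commutator_sup_powClosure_pow K Q hKQ q hKle a hk
    have hbot : Subgroup.closure ((fun y : G => y ^ q ^ a) '' (K : Set G)) = ⊥ := by
      rw [Subgroup.closure_eq_bot_iff]
      rintro _ ⟨y, hy, rfl⟩
      exact pow_pow_eq_one_of_card_eq K hpq ha hy
    rwa [hbot, sup_bot_eq] at h
  -- hence `K ≤ γ_i(Q)` for all `i`, and `Q` is nilpotent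
  have hle : ∀ i, K ≤ Q.lowerCentralSeries i := by
    intro i
    induction i with
    | zero => rw [Subgroup.lowerCentralSeries_zero]; exact hKQ
    | succ i ih =>
      rw [Subgroup.lowerCentralSeries_succ]
      exact hKM.trans (Subgroup.commutator_mono ih le_rfl)
  haveI : Group.IsNilpotent Q := hQ.isNilpotent
  obtain ⟨n, hn⟩ := (Subgroup.isNilpotent_iff_lowerCentralSeries Q).mp inferInstance
  exact le_bot_iff.mp (hn ▸ hle n)

/-- **The lower `q`-central series of a finite `p`-group terminates** (`p ∣ q`): if `D 0 = Q` and
`D (j+1) = ⁅D j, Q⁆ ⊔ ⟨{y ^ q | y ∈ D j}⟩`, then `D c = ⊥` for some `c`.  (As long as `D j ≠ ⊥` the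
series strictly decreases, by `eq_bot_of_le_commutator_sup_powClosure`.)
[cite: DDMSAnalyticProP1999, Prop 1.16] -/
theorem exists_lowerPowSeries_eq_bot {p : ℕ} [hp : Fact p.Prime] (Q : Subgroup G) [hQn : Q.Normal]
    [Finite Q] (hQ : IsPGroup p Q) {q : ℕ} (hpq : p ∣ q) (D : ℕ → Subgroup G) (hD0 : D 0 = Q)
    (hDs : ∀ j, D (j + 1) = ⁅D j, Q⁆ ⊔ Subgroup.closure ((fun y : G => y ^ q) '' (D j : Set G))) :
    ∃ c, D c = ⊥ := by
  -- basic properties of the series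
  have hle : ∀ j, D j ≤ Q := by
    intro j
    induction j with
    | zero => rw [hD0]
    | succ j ih =>
      rw [hDs]
      refine sup_le (Subgroup.commutator_le_right _ _) ?_
      rw [Subgroup.closure_le]
      rintro _ ⟨y, hy, rfl⟩
      exact Q.pow_mem (ih hy) q
  have hnormal : ∀ j, (D j).Normal := by
    intro j
    induction j with
    | zero => rw [hD0]; exact hQn
    | succ j ih =>
      haveI := ih
      -- the power part is normal: conjugation permutes the generators
      haveI : (Subgroup.closure ((fun y : G => y ^ q) '' (D j : Set G))).Normal := by
        refine ⟨fun n hn g => ?_⟩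
        induction hn using Subgroup.closure_induction with
        | mem z hz =>
          obtain ⟨y, hy, rfl⟩ := hz
          refine Subgroup.subset_closure ⟨g * y * g⁻¹, ih.conj_mem y hy g, ?_⟩
          show (g * y * g⁻¹) ^ q = g * y ^ q * g⁻¹
          exact conj_pow
        | one => rw [mul_one, mul_inv_cancel]; exact Subgroup.one_mem _
        | mul z z' _ _ ih₁ ih₂ =>
          have : g * (z * z') * g⁻¹ = (g * z * g⁻¹) * (g * z' * g⁻¹) := by group
          rw [this]; exact Subgroup.mul_mem _ ih₁ ih₂
        | inv z _ ih₁ =>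
          have : g * z⁻¹ * g⁻¹ = (g * z * g⁻¹)⁻¹ := by group
          rw [this]; exact Subgroup.inv_mem _ ih₁
      rw [hDs]
      infer_instance
  have hanti : ∀ j, D (j + 1) ≤ D j := by
    intro j
    haveI := hnormal j
    rw [hDs]
    refine sup_le (Subgroup.commutator_le_left _ _) ?_
    rw [Subgroup.closure_le]
    rintro _ ⟨y, hy, rfl⟩
    exact (D j).pow_mem hy q
  -- strict decrease while nontrivial
  have key : ∀ j, D j = ⊥ ∨ Nat.card (D j) + j ≤ Nat.card Q := by
    intro j
    induction j with
    | zero => right; rw [hD0, add_zero]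
    | succ j ih =>
      rcases ih with h | h
      · left; exact le_bot_iff.mp (h ▸ hanti j)
      · by_cases heq : D (j + 1) = D j
        · left
          haveI := hnormal j
          have hKle : D j ≤ ⁅D j, Q⁆ ⊔
              Subgroup.closure ((fun y : G => y ^ q) '' (D j : Set G)) := by
            rw [← hDs j, heq]
          rw [heq]
          exact eq_bot_of_le_commutator_sup_powClosure (D j) Q hQ (hle j) hpq hKle
        · right
          haveI : Finite (D j) := Finite.of_injective _ (Subgroup.inclusion_injective (hle j))
          have hlt : Nat.card (D (j + 1)) < Nat.card (D j) := by
            by_contra hge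
            exact heq (Subgroup.eq_of_le_of_card_ge (hanti j) (not_lt.mp hge))
          omega
  refine ⟨Nat.card Q + 1, ?_⟩
  rcases key (Nat.card Q + 1) with h | h
  · exact h
  · omega

end Literature.GroupTheory
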